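import Summits.QuantumFields.YangMills.Theorems.BalabanUVNodesN22AtRecordOfOutputLevel
import Summits.QuantumFields.YangMills.Theorems.BalabanUVNodesN22AtRecordOfOutputValue

/-!
# NODE N22 (NE9) ∕ (D4) — THE PRINT-LEVEL EDITION: K3⁷ v5 §2b's `h9` ∕ `hdec` and the N22 ∕ (D4) pin faces AT THE RECORD from OUTPUT-level coupling holomorphy of the (2.13) terms
# in EVERY coupling ([I] p. 266 read quantitatively) ∕ printed (1.18) `TermBound118`, with the TERM holomorphy through the complexified readings DISCHARGED from PRINTED (2.38)
# `Bound238` + PRINTED configuration analyticity `AnalyticH` ([II] p. 15) by dag-n22-c's parametric Kotecký–Preiss engine (J30 v1.1) ∘ J32′ §1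

Cell `pub-ymgap`, Track A (HUMAN RULING D-0062), WIDTH SEAT `dag-n22-w5` (g0′, harness re-seat of base w5) on node n22 = NE9, D-0154 (3a) second width wave;
`--kind proof --supports stmt-QuantumFields-20544 --as helper` (K3⁷ `SpineGivenEndpointR13SepCoPH`, skeleton v5 941dddb108cbaacf), COUNT-NEUTRAL; THEOREMS ONLY (0 `def`,
0 `sorry`, standard axioms).  Self-located in this seat's own lineage (the record editions; CLAIM-4 ∕ INTENT-4 on the bus).  In `…N22AtRecordOfOutputLevel` (this seat's g0,
p616135; J34 at the record) and `…N22AtRecordOfOutputValue` §2 (this seat, J36 at the record) ONE displayed input is not of print's level: `hEhol` — holomorphy of the (2.13) TERM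
`z ↦ E^{(k+1)}(X; histPrefix g k; Φ K k X z)` through the complexified probe reading.  Print's statement ([II] p. 15 «We consider it as an analytic function of (𝐔,𝐉) in the space
U^c_{k+1}(X, α₀, α₁)») is about the ACTIVITIES ∕ their terms — node00-def-W1's PRINTED slot `AnalyticH`; the TERM inherits holomorphy through the cluster expansion under printed
(2.38) and Road 1's numerals — dag-n22-c J30 v1.1's engine `differentiableOn_and_norm_clusterStepE_comp_le_of_activityHol` (p602155) after J32′ §1 `differentiableOn_H_comp_of_analyticH`.
THIS FILE makes that substitution, one application per theorem; nothing of J30 ∕ J32′ ∕ J34 ∕ J36 ∕ p616135 ∕ `…OutputValue` is re-declared.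

WHAT.  ★★★ `ne9_EA_objectsOfRecord₁₃_of_outputCoordHolo_analyticH` ∕ ★★★ `n22At_rateCarriers_of_kernels_pin_of_outputCoordHolo_analyticH` — towers `S K : ClusterTower (F.P K) 𝔸 M`
(`M = L^{m′}`; `𝔸` a normed ℂ-algebra) read through `emb : ReadingMaps F (MatA N) 𝔸` with W1-20's law `Localizes17OfRecord₁₃ F N θ S emb`; per `(K, k, i)`: OUTPUT-level coupling
HOLOMORPHY of the terms on uniform margins — a holomorphic extension of `t ↦ E^{(k+1)}(X; g|g_i := t; φ)` to a set containing the closed `ρt (k+1) i`-discs about `]0, θ.γ]`, bounded by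
`B·e^{−κ_E d_{k+1}(X)}`, `κ ≤ κ_E` ([I] p. 266 «𝐄^{(j)} … analytic functions of the effective coupling constants», quantified); PRINTED (2.38) `Bound238 (box θ.γ k) (sp K k) A R` and
PRINTED `AnalyticH (box θ.γ k) (sp K k)`; Road 1's numerals (`0 ≤ A`, `0 ≤ r₁`, `r₁ + 128 log 162 + 2 ≤ R`, `A·e^{5r₁+1}K₀(64,8)·9·64 ≤ 1`); HOLOMORPHIC complexified probe readings
`Φ K k X` of the record's β-chart on open `U K k X ⊇ ball 0 r` with the chart clause and the space clause in dag-n22-w3's form (`U` mapped into `sp K k Z` for every `Z ⊆ X`); site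
weights with the minimizer tails ([I] p. 282), `δ₀ > 0`, `2κ₀(64,8) ≤ κ`; `PolLimitsExistOfRecord₁₃ F N θ`; a dominating letter block (`ℓ.κ ≤ δ₁`, `C·4B∕ρt ≤ ℓ.moduli`) ⟹ v5 §2b's
`h9` and, under `hpin`, the N22 pin face ∀ k — p616135 `…_of_outputCoordHolo` with `hEhol := (J30 v1.1 engine ∘ J32′ §1)`.  ★★★ `kernelDecayOfRecord₁₃_of_termBound118_analyticH` ∕ ★★★
`readOutAt_rateCarriers_of_kernels_pin_of_termBound118_analyticH` — `hdec` at any `κ′ ≤ δ₁` and the (D4) pin face ∀ k from printed (1.18) `TermBound118 (S K) (Window θ.γ) (spj K) B κ_E` +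
PRINTED (2.38) + PRINTED `AnalyticH` (tables `spj K (k+1)`) + numerals + holomorphic readings + tails + (1.21) — `…OutputValue` §2 `…_of_termBound118` likewise.  §1b ★★★
`ne9_EA_objectsOfRecord₁₃_of_outputCoordLetters_analyticH` ∕ ★★★ `n22At_rateCarriers_of_kernels_pin_of_outputCoordLetters_analyticH` — the same with per-coordinate OUTPUT-level coupling
LIPSCHITZ LETTERS (NE9's literal currency, moduli `Λt`) in place of the margins (p616135 `…_of_outputCoordLetters` with `hEhol := §0`).
THE N22 ∕ (D4) ROW SENTENCES IN PRINT-LEVEL CURRENCY: «W1-20's law + [I] p. 266 coupling analyticity of the (2.13) terms on uniform margins (resp. printed (1.18)) + printed (2.38) +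
printed configuration analyticity + holomorphic minimizer readings + p. 282 tails + (1.21) existence + numerals + a dominating letter block ⇒ `h9` ∕ `hdec` ∕ the pin faces at the pinned
bundle, every run length».

HONEST FRAMING (binding).  Count-neutral COMPOSITION of landed theorems by name; NO estimate of Bałaban's is proved or asserted; every displayed input is a HYPOTHESIS with its
owner (output-level coupling margins: N10 ∕ NODE A for the older couplings, N09 for the last — the uniform margin is the cell's QUANTIFIED reading of [I] p. 263 ∕ p. 266 «C^∞ (or
analytic)», NOT a printed estimate; printed (2.38) ∕ `AnalyticH` ∕ (1.18) at NODE A's towers: N10 ∕ NODE A; readings + tails: NODE A ∕ N09; law: NODE A ∕ N10 ∕ def-W1; (1.21):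
dag-n22-w3's road); nothing of the record is constructed or claimed to meet them; N22 and (D4) are NOT discharged (typed 28∕28 · discharged 5∕27 UNCHANGED); K3⁷ OPEN and NOT claimed;
NE9 is NOT IN PRINT for d = 4; no count claim (the chair's single count line is the only count); no summit statement is proved by this seat; one finite 𝕋⁴ programme at fixed ε —
R4 closes the CONDITIONAL rung `BalabanLadder.UV` only; NOTHING about the continuum limit, ℝ⁴, infinite volume, OS axioms, a mass gap or the Clay problem is proved or claimed by any
of this.  A5∕A6: the S-side slot binders `h238` ∕ `hAn` are inhabited non-termlessly by dag-n22-w1 g3's phase towers (p616700, MODEL towers — not the record's); the output-level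
margins at the termless step by J34 `outputCoordLetters_termlessStep` (DEGENERATE, declared).  References (TYPES only, no cite tags on the Summit side): [I] = Bałaban, CMP 109 (1987)
(1.7) p. 261, §1 p. 263, §2 p. 266, (1.18) p. 263, (1.20)–(1.21) p. 264, p. 282, (5.10) p. 293; [II] = CMP 116 (1988) (2.13)–(2.14) pp. 14–15, p. 15, (2.38) p. 20, (2.41) p. 21.
-/

noncomputable section

open Filter Topology Metric Set
open scoped BigOperators

namespace YMDAG.N22.AtRecordOfPrintedSlots

open Literature.MathematicalPhysics.QuantumFieldTheory.Balaban1983to89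
open Literature.MathematicalPhysics.QuantumFieldTheory.Balaban1983to89.T4Continuum (T4Family ULoop)
open Literature.MathematicalPhysics.QuantumFieldTheory.Balaban1983to89.T4OutputRate (Window NE9)
open Literature.MathematicalPhysics.QuantumFieldTheory.Balaban1983to89.Node00 (Stage13Params Stage13HParams U3Letters₁₁ MatA datumOfRecord₁₃CoPH)
open Literature.MathematicalPhysics.QuantumFieldTheory.Balaban1983to89.Node00.Sect2 (domCount domSys CPair)
open Literature.MathematicalPhysics.QuantumFieldTheory.Balaban1983to89.Node00.LocalizedSum17 (ReadingMaps Localizes17OfRecord₁₃)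
open Literature.MathematicalPhysics.QuantumFieldTheory.Balaban1983to89.Node00.W1 (ClusterTower ClusterStep TermBound118 box)
open Literature.MathematicalPhysics.QuantumFieldTheory.Balaban1983to89.Node00.U3OfKernels (histPrefix objectsOfRecord₁₃ KernelDecayOfRecord₁₃)
open Literature.MathematicalPhysics.QuantumFieldTheory.Balaban1983to89.Node00.U3KernelLetters (PolLimitsExistOfRecord₁₃)
open Literature.MathematicalPhysics.QuantumFieldTheory.Balaban1983to89.B12Decay510 (delta1)
open Literature.MathematicalPhysics.QuantumFieldTheory.Balaban1983to89.B12Decay510Window (K₁)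
open Literature.MathematicalPhysics.QuantumFieldTheory.Balaban1983to89.B12Decay510Torus (distCT nearT)
open Literature.MathematicalPhysics.QuantumFieldTheory.Balaban1983to89.B12TreeDecay (K₀ kappa₀)
open Literature.MathematicalPhysics.QuantumFieldTheory.Balaban1983to89.TreeLengthTorus (TPt)
open Literature.MathematicalPhysics.QuantumFieldTheory.Balaban1983to89.B12Sec2to5 (betaPrime510)
open YMDAG.UVSplit (N22At ReadOutAt RateReading₁₃CoPH rateCarriersOfRecord₁₃CoPH)
open YMDAG.N22.WindowedOfCouplingHolo (differentiableOn_H_comp_of_analyticH histPrefix_mem_box)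
open YMDAG.N22.WindowOfLocalTerms (differentiableOn_and_norm_clusterStepE_comp_le_of_activityHol)

open scoped Matrix.Norms.L2Operator

variable (F : T4Family) (N : ℕ) [NeZero N]

/-! ## §0 The one substitution: TERM holomorphy through a holomorphic reading from PRINTED (2.38) + PRINTED `AnalyticH` (J30 v1.1's engine ∘ J32′ §1) -/

/-- **TERM HOLOMORPHY THROUGH THE READINGS FROM PRINT'S SLOTS.**  For towers `S`, prefix sets `box γ k`, space tables `sp`: PRINTED (2.38) `Bound238` + Road 1's numerals + PRINTED
`AnalyticH` + holomorphic readings `Φ K k X` on open `U K k X` mapping `U` into `sp K k Z` for every `Z ⊆ X` ⟹ for every window history `g ∈ ]0, γ]^ℕ` the (2.13) TERM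
`z ↦ E^{(k+1)}(X; histPrefix g k; Φ K k X z)` is holomorphic on `U K k X` — dag-n22-c's `differentiableOn_and_norm_clusterStepE_comp_le_of_activityHol` (J30 v1.1) at the activity
family made holomorphic by `differentiableOn_H_comp_of_analyticH` (J32′ §1).  [II] p. 15's analyticity statement, pushed through (2.13). -/
theorem differentiableOn_E_comp_of_printedSlots {𝔸 : Type*} [NormedRing 𝔸] [NormedAlgebra ℂ 𝔸] {M : ℕ}
    (S : (K : ℕ) → ClusterTower (F.P K) 𝔸 M) {γ : ℝ} (sp : (K k : ℕ) → (domSys (F.P K) M (k + 1)).Dom → Set (CPair (F.P K) 𝔸)) {A R r₁ : ℝ}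
    (hA : 0 ≤ A) (hr₁ : 0 ≤ r₁) (hrate : r₁ + 2 * (64 * Real.log 162) + 2 ≤ R) (hsmall : A * Real.exp (5 * r₁ + 1) * K₀ 64 8 * 9 * 64 ≤ 1)
    (h238 : ∀ K k, ((S K) k).Bound238 (box γ k) (sp K k) A R) (hAn : ∀ K k, ((S K) k).AnalyticH (box γ k) (sp K k))
    (Ec : ℕ → ℕ → Type*) [∀ K k, NormedAddCommGroup (Ec K k)] [∀ K k, NormedSpace ℂ (Ec K k)]
    (Φ : (K k : ℕ) → (domSys (F.P K) M (k + 1)).Dom → Ec K k → CPair (F.P K) 𝔸)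
    (U : (K k : ℕ) → (domSys (F.P K) M (k + 1)).Dom → Set (Ec K k)) (hU : ∀ K k X, IsOpen (U K k X))
    (hΦhol : ∀ (K k : ℕ) (X : (domSys (F.P K) M (k + 1)).Dom), DifferentiableOn ℂ (Φ K k X) (U K k X))
    (hΦsp : ∀ (K k : ℕ) (X : (domSys (F.P K) M (k + 1)).Dom), ∀ z ∈ U K k X, ∀ Z : (domSys (F.P K) M (k + 1)).Dom, Z.1 ⊆ X.1 → Φ K k X z ∈ sp K k Z) :
    ∀ g ∈ Window γ, ∀ (K k : ℕ) (X : (domSys (F.P K) M (k + 1)).Dom), DifferentiableOn ℂ (fun z => ((S K) k).E (histPrefix g k) (Φ K k X z) X) (U K k X) :=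
  fun _ hg K k X =>
    (differentiableOn_and_norm_clusterStepE_comp_le_of_activityHol F K ((S K) k) (box γ k) (sp K k) hA hr₁ hrate hsmall (h238 K k) (histPrefix_mem_box hg k) X
      (Φ K k X) (hU K k X)
      (differentiableOn_H_comp_of_analyticH ((S K) k) (box γ k) (sp K k) (hAn K k) (histPrefix_mem_box hg k) (Φ K k X) (hΦhol K k X) X (hΦsp K k X))
      (hΦsp K k X)).1

/-- The space clause in dag-n22-w3's form (`U` into `sp K k Z` for every `Z ⊆ X`) implies J34's (the ball `⊆ U` into `sp K k X`). -/
theorem ball_mem_sp_of_spaceClause {𝔸 : Type*} {M : ℕ} (sp : (K k : ℕ) → (domSys (F.P K) M (k + 1)).Dom → Set (CPair (F.P K) 𝔸)) {r : ℝ}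
    (Ec : ℕ → ℕ → Type*) [∀ K k, NormedAddCommGroup (Ec K k)] [∀ K k, NormedSpace ℂ (Ec K k)]
    (Φ : (K k : ℕ) → (domSys (F.P K) M (k + 1)).Dom → Ec K k → CPair (F.P K) 𝔸)
    (U : (K k : ℕ) → (domSys (F.P K) M (k + 1)).Dom → Set (Ec K k)) (hrU : ∀ K k X, ball (0 : Ec K k) r ⊆ U K k X)
    (hΦsp : ∀ (K k : ℕ) (X : (domSys (F.P K) M (k + 1)).Dom), ∀ z ∈ U K k X, ∀ Z : (domSys (F.P K) M (k + 1)).Dom, Z.1 ⊆ X.1 → Φ K k X z ∈ sp K k Z) :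
    ∀ (K k : ℕ) (X : (domSys (F.P K) M (k + 1)).Dom), ∀ z ∈ ball (0 : Ec K k) r, Φ K k X z ∈ sp K k X :=
  fun K k X z hz => hΦsp K k X z (hrU K k X hz) X subset_rfl

/-! ## §1 `h9` and the N22 pin face from OUTPUT-level coupling holomorphy + print's slots -/

open Classical in
/-- ★★★ **K3⁷ v5 §2b's `h9` FROM OUTPUT-LEVEL COUPLING HOLOMORPHY IN EVERY COUPLING + PRINTED (2.38) + PRINTED `AnalyticH`.**  p616135's `ne9_EA_objectsOfRecord₁₃_of_outputCoordHolo` (J34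
at the record) with its term-holomorphy binder `hEhol` DISCHARGED by §0 `differentiableOn_E_comp_of_printedSlots` and the space clause read in dag-n22-w3's form (§0
`ball_mem_sp_of_spaceClause`): law `Localizes17OfRecord₁₃ F N θ S emb` + one holomorphy datum `hL` per `(K, k, i)` for the (2.13) terms in the coupling `g_i` on uniform margins
`ρt (k+1) i` (bound `B·e^{−κ_E d_{k+1}(X)}`, `κ ≤ κ_E`) + `Bound238` ∕ `AnalyticH` on the boxes + numerals + holomorphic readings with chart∕space clauses + tails + `2κ₀(64,8) ≤ κ`, `δ₀ > 0`
+ `PolLimitsExistOfRecord₁₃ F N θ` + a dominating letter block ⟹ `NE9 ((objectsOfRecord₁₃ F N θ ℓ).EA 0) (Window θ.γ) ℓ.κ ℓ.moduli`.  LOCATED (hypothesis form); N22 NOT discharged. -/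
theorem ne9_EA_objectsOfRecord₁₃_of_outputCoordHolo_analyticH (θ : Stage13Params F N) (ℓ : U3Letters₁₁) (hs : ℓ.Signs) (hlim : PolLimitsExistOfRecord₁₃ F N θ)
    {𝔸 : Type*} [NormedRing 𝔸] [NormedAlgebra ℂ 𝔸] (m' : ℕ) (M : ℕ) [NeZero M] (hM : M = F.L ^ m')
    (S : (K : ℕ) → ClusterTower (F.P K) 𝔸 M) (emb : ReadingMaps F (MatA N) 𝔸) (hloc : Localizes17OfRecord₁₃ F N θ S emb)
    (sp : (K k : ℕ) → (domSys (F.P K) M (k + 1)).Dom → Set (CPair (F.P K) 𝔸))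
    {A R r₁ κ κE δ₀ B₃ r B : ℝ} (ρt : ℕ → ℕ → ℝ) (hρt : ∀ n i, 0 < ρt n i)
    (hA : 0 ≤ A) (hr₁ : 0 ≤ r₁) (hrate : r₁ + 2 * (64 * Real.log 162) + 2 ≤ R) (hsmall : A * Real.exp (5 * r₁ + 1) * K₀ 64 8 * 9 * 64 ≤ 1)
    (hκ₀ : kappa₀ (4 * 2 ^ 4) (2 * 4) ≤ κ / 2) (hδ₀ : 0 < δ₀) (hB₃ : 0 ≤ B₃) (hr : 0 < r) (hB : 0 ≤ B) (hκE : κ ≤ κE)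
    (hL : ∀ (K k : ℕ) (i : Fin (k + 1)), ∀ g ∈ box θ.γ k, ∀ (X : (domSys (F.P K) M (k + 1)).Dom), ∀ φ ∈ sp K k X,
      ∃ (Ec : ℂ → ℂ) (O : Set ℂ), DifferentiableOn ℂ Ec O ∧ (∀ t ∈ Ioc (0 : ℝ) θ.γ, closedBall (t : ℂ) (ρt (k + 1) i) ⊆ O) ∧
        (∀ z ∈ O, ‖Ec z‖ ≤ B * Real.exp (-(κE * (domSys (F.P K) M (k + 1)).dj X))) ∧
        (∀ t ∈ Ioc (0 : ℝ) θ.γ, Ec t = ((S K) k).E (Function.update g i t) φ X))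
    (h238 : ∀ K k, ((S K) k).Bound238 (box θ.γ k) (sp K k) A R) (hAn : ∀ K k, ((S K) k).AnalyticH (box θ.γ k) (sp K k))
    (Ec : ℕ → ℕ → Type*) [∀ K k, NormedAddCommGroup (Ec K k)] [∀ K k, NormedSpace ℂ (Ec K k)]
    (ι : letI := θ.instVβ₁; letI := θ.instVβ₂
      (K k : ℕ) → (domSys (F.P K) M (k + 1)).Dom → ((Fin (F.P K).d → Site (F.P K) (k + 1) → θ.Vβ) →L[ℝ] Ec K k))
    (Φ : (K k : ℕ) → (domSys (F.P K) M (k + 1)).Dom → Ec K k → CPair (F.P K) 𝔸)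
    (U : (K k : ℕ) → (domSys (F.P K) M (k + 1)).Dom → Set (Ec K k)) (hU : ∀ K k X, IsOpen (U K k X)) (hrU : ∀ K k X, ball (0 : Ec K k) r ⊆ U K k X)
    (hΦhol : ∀ (K k : ℕ) (X : (domSys (F.P K) M (k + 1)).Dom), DifferentiableOn ℂ (Φ K k X) (U K k X))
    (hΦemb : letI := θ.instVβ₁; letI := θ.instVβ₂
      ∀ (K k : ℕ) (X : (domSys (F.P K) M (k + 1)).Dom) (B : Fin (F.P K).d → Site (F.P K) (k + 1) → θ.Vβ),
        Φ K k X (ι K k X B) = emb K k (fun l t => NormedSpace.exp (θ.ρ8 (B l t))))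
    (hΦsp : ∀ (K k : ℕ) (X : (domSys (F.P K) M (k + 1)).Dom), ∀ z ∈ U K k X, ∀ Z : (domSys (F.P K) M (k + 1)).Dom, Z.1 ⊆ X.1 → Φ K k X z ∈ sp K k Z)
    (w : (K k : ℕ) → (domSys (F.P K) M (k + 1)).Dom → Site (F.P K) (k + 1) → ℝ) (hw₀ : ∀ K k X t, 0 ≤ w K k X t)
    (hw : letI := θ.instVβ₁; letI := θ.instVβ₂; letI := θ.instιβ
      ∀ (K k : ℕ) (X : (domSys (F.P K) M (k + 1)).Dom) (l : Fin (F.P K).d) (t : Site (F.P K) (k + 1)) (c : θ.ιβ),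
        ‖ι K k X (Pi.single l (Pi.single t (θ.bV c)))‖ ≤ w K k X t)
    (htail : ∀ (K k : ℕ) (X : (domSys (F.P K) M (k + 1)).Dom) (t : Site (F.P K) (k + 1)),
      let e : Site (F.P K) (k + 1) → TPt 4 (domCount (F.P K) M (k + 1) * M) := fun x i => (ZMod.cast (x i) : ZMod (domCount (F.P K) M (k + 1) * M))
      w K k X t ≤ B₃ * Real.exp (-δ₀ * distCT (domCount (F.P K) M (k + 1)) M (e t) (nearT (M := M) (e t) X)))
    (hℓκ : ℓ.κ ≤ delta1 δ₀ κ ((M : ℝ) * 4))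
    (hdom : ∀ n i, 16 * B₃ ^ 2 / r ^ 2 * Real.exp (delta1 δ₀ κ ((M : ℝ) * 4) * ((M : ℝ) * 4) * 3) * K₀ (4 * 2 ^ 4) (2 * 4) * K₁ 4 (δ₀ / 2) *
        (4 * B / ρt n i) ≤ ℓ.moduli n i) :
    NE9 ((objectsOfRecord₁₃ F N θ ℓ).EA 0) (Window θ.γ) ℓ.κ ℓ.moduli :=
  ne9_EA_objectsOfRecord₁₃_of_outputCoordHolo F N θ ℓ hs hlim m' M hM S emb hloc sp ρt hρt hκ₀ hδ₀ hB₃ hr hB hκE hL Ec ι Φ U hU hrU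
    (differentiableOn_E_comp_of_printedSlots F S sp hA hr₁ hrate hsmall h238 hAn Ec Φ U hU hΦhol hΦsp)
    hΦemb (ball_mem_sp_of_spaceClause F sp Ec Φ U hrU hΦsp) w hw₀ hw htail hℓκ hdom

open Classical in
/-- ★★★ **THE N22 PIN FACE IN PRINT-LEVEL CURRENCY** — `N22At (rateCarriersOfRecord₁₃CoPH 𝔯 F θ hP g₀ os k).u3` for EVERY `k` under `hpin`: p616135's
`n22At_rateCarriers_of_kernels_pin_of_outputCoordHolo` with `hEhol` DISCHARGED from PRINTED (2.38) + PRINTED `AnalyticH` (§0).  «W1-20's law + [I] p. 266 coupling analyticity of the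
terms on uniform margins + printed (2.38) + printed configuration analyticity + holomorphic minimizer readings + p. 282 tails + (1.21) + numerals + a dominating letter block ⇒ `N22At` at
the pinned bundle, every run length».  LOCATED (hypothesis form); N22 NOT discharged. -/
theorem n22At_rateCarriers_of_kernels_pin_of_outputCoordHolo_analyticH (𝔯 : RateReading₁₃CoPH N) (θ : Stage13HParams F N) (hP : θ.Provisos₁₃CoPH F N)
    (g₀ : ℕ → ℝ) (os : List (ULoop F)) (ℓ : U3Letters₁₁) (hs : ℓ.Signs) (hpin : (𝔯.lit F θ hP g₀ os).u3 = objectsOfRecord₁₃ F N θ.toStage13Params ℓ)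
    (hlim : PolLimitsExistOfRecord₁₃ F N θ.toStage13Params) {𝔸 : Type*} [NormedRing 𝔸] [NormedAlgebra ℂ 𝔸] (m' : ℕ) (M : ℕ) [NeZero M] (hM : M = F.L ^ m')
    (S : (K : ℕ) → ClusterTower (F.P K) 𝔸 M) (emb : ReadingMaps F (MatA N) 𝔸) (hloc : Localizes17OfRecord₁₃ F N θ.toStage13Params S emb)
    (sp : (K k : ℕ) → (domSys (F.P K) M (k + 1)).Dom → Set (CPair (F.P K) 𝔸))
    {A R r₁ κ κE δ₀ B₃ r B : ℝ} (ρt : ℕ → ℕ → ℝ) (hρt : ∀ n i, 0 < ρt n i)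
    (hA : 0 ≤ A) (hr₁ : 0 ≤ r₁) (hrate : r₁ + 2 * (64 * Real.log 162) + 2 ≤ R) (hsmall : A * Real.exp (5 * r₁ + 1) * K₀ 64 8 * 9 * 64 ≤ 1)
    (hκ₀ : kappa₀ (4 * 2 ^ 4) (2 * 4) ≤ κ / 2) (hδ₀ : 0 < δ₀) (hB₃ : 0 ≤ B₃) (hr : 0 < r) (hB : 0 ≤ B) (hκE : κ ≤ κE)
    (hL : ∀ (K k : ℕ) (i : Fin (k + 1)), ∀ g ∈ box θ.γ k, ∀ (X : (domSys (F.P K) M (k + 1)).Dom), ∀ φ ∈ sp K k X,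
      ∃ (Ec : ℂ → ℂ) (O : Set ℂ), DifferentiableOn ℂ Ec O ∧ (∀ t ∈ Ioc (0 : ℝ) θ.γ, closedBall (t : ℂ) (ρt (k + 1) i) ⊆ O) ∧
        (∀ z ∈ O, ‖Ec z‖ ≤ B * Real.exp (-(κE * (domSys (F.P K) M (k + 1)).dj X))) ∧
        (∀ t ∈ Ioc (0 : ℝ) θ.γ, Ec t = ((S K) k).E (Function.update g i t) φ X))
    (h238 : ∀ K k, ((S K) k).Bound238 (box θ.γ k) (sp K k) A R) (hAn : ∀ K k, ((S K) k).AnalyticH (box θ.γ k) (sp K k))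
    (Ec : ℕ → ℕ → Type*) [∀ K k, NormedAddCommGroup (Ec K k)] [∀ K k, NormedSpace ℂ (Ec K k)]
    (ι : letI := θ.instVβ₁; letI := θ.instVβ₂
      (K k : ℕ) → (domSys (F.P K) M (k + 1)).Dom → ((Fin (F.P K).d → Site (F.P K) (k + 1) → θ.Vβ) →L[ℝ] Ec K k))
    (Φ : (K k : ℕ) → (domSys (F.P K) M (k + 1)).Dom → Ec K k → CPair (F.P K) 𝔸)
    (U : (K k : ℕ) → (domSys (F.P K) M (k + 1)).Dom → Set (Ec K k)) (hU : ∀ K k X, IsOpen (U K k X)) (hrU : ∀ K k X, ball (0 : Ec K k) r ⊆ U K k X)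
    (hΦhol : ∀ (K k : ℕ) (X : (domSys (F.P K) M (k + 1)).Dom), DifferentiableOn ℂ (Φ K k X) (U K k X))
    (hΦemb : letI := θ.instVβ₁; letI := θ.instVβ₂
      ∀ (K k : ℕ) (X : (domSys (F.P K) M (k + 1)).Dom) (B : Fin (F.P K).d → Site (F.P K) (k + 1) → θ.Vβ),
        Φ K k X (ι K k X B) = emb K k (fun l t => NormedSpace.exp (θ.ρ8 (B l t))))
    (hΦsp : ∀ (K k : ℕ) (X : (domSys (F.P K) M (k + 1)).Dom), ∀ z ∈ U K k X, ∀ Z : (domSys (F.P K) M (k + 1)).Dom, Z.1 ⊆ X.1 → Φ K k X z ∈ sp K k Z)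
    (w : (K k : ℕ) → (domSys (F.P K) M (k + 1)).Dom → Site (F.P K) (k + 1) → ℝ) (hw₀ : ∀ K k X t, 0 ≤ w K k X t)
    (hw : letI := θ.instVβ₁; letI := θ.instVβ₂; letI := θ.instιβ
      ∀ (K k : ℕ) (X : (domSys (F.P K) M (k + 1)).Dom) (l : Fin (F.P K).d) (t : Site (F.P K) (k + 1)) (c : θ.ιβ),
        ‖ι K k X (Pi.single l (Pi.single t (θ.bV c)))‖ ≤ w K k X t)
    (htail : ∀ (K k : ℕ) (X : (domSys (F.P K) M (k + 1)).Dom) (t : Site (F.P K) (k + 1)),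
      let e : Site (F.P K) (k + 1) → TPt 4 (domCount (F.P K) M (k + 1) * M) := fun x i => (ZMod.cast (x i) : ZMod (domCount (F.P K) M (k + 1) * M))
      w K k X t ≤ B₃ * Real.exp (-δ₀ * distCT (domCount (F.P K) M (k + 1)) M (e t) (nearT (M := M) (e t) X)))
    (hℓκ : ℓ.κ ≤ delta1 δ₀ κ ((M : ℝ) * 4))
    (hdom : ∀ n i, 16 * B₃ ^ 2 / r ^ 2 * Real.exp (delta1 δ₀ κ ((M : ℝ) * 4) * ((M : ℝ) * 4) * 3) * K₀ (4 * 2 ^ 4) (2 * 4) * K₁ 4 (δ₀ / 2) *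
        (4 * B / ρt n i) ≤ ℓ.moduli n i) (k : ℕ) :
    N22At (rateCarriersOfRecord₁₃CoPH 𝔯 F θ hP g₀ os k).u3 :=
  n22At_rateCarriers_of_kernels_pin_of_outputCoordHolo F N 𝔯 θ hP g₀ os ℓ hs hpin hlim m' M hM S emb hloc sp ρt hρt hκ₀ hδ₀ hB₃ hr hB hκE hL Ec ι Φ U hU hrU
    (differentiableOn_E_comp_of_printedSlots F S sp hA hr₁ hrate hsmall h238 hAn Ec Φ U hU hΦhol hΦsp)
    hΦemb (ball_mem_sp_of_spaceClause F sp Ec Φ U hrU hΦsp) w hw₀ hw htail hℓκ hdom k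

/-! ## §1b The same from OUTPUT-level coupling LIPSCHITZ LETTERS (NE9's literal currency) + print's slots -/

open Classical in
/-- ★★★ **K3⁷ v5 §2b's `h9` FROM OUTPUT-LEVEL COUPLING LETTERS IN EVERY COUPLING + PRINTED (2.38) + PRINTED `AnalyticH`.**  p616135's `ne9_EA_objectsOfRecord₁₃_of_outputCoordLetters` with
`hEhol` DISCHARGED by §0: law + per-coordinate OUTPUT-level coupling-Lipschitz letters `‖E^{(k+1)}(X; g; φ) − E^{(k+1)}(X; g|g_i := t; φ)‖ ≤ Λt (k+1) i·e^{−κ d_{k+1}(X)}·|g_i − t|` on the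
boxes ([I] p. 263 ∕ p. 266 quantified; NE9's own currency) + `Bound238` ∕ `AnalyticH` on the boxes + numerals + holomorphic readings with chart∕space clauses + tails + `2κ₀(64,8) ≤ κ`,
`δ₀ > 0` + `PolLimitsExistOfRecord₁₃ F N θ` + a dominating letter block (`C·Λt ≤ ℓ.moduli`) ⟹ `NE9 ((objectsOfRecord₁₃ F N θ ℓ).EA 0) (Window θ.γ) ℓ.κ ℓ.moduli`.  LOCATED (hypothesis
form); N22 NOT discharged. -/
theorem ne9_EA_objectsOfRecord₁₃_of_outputCoordLetters_analyticH (θ : Stage13Params F N) (ℓ : U3Letters₁₁) (hs : ℓ.Signs) (hlim : PolLimitsExistOfRecord₁₃ F N θ)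
    {𝔸 : Type*} [NormedRing 𝔸] [NormedAlgebra ℂ 𝔸] (m' : ℕ) (M : ℕ) [NeZero M] (hM : M = F.L ^ m')
    (S : (K : ℕ) → ClusterTower (F.P K) 𝔸 M) (emb : ReadingMaps F (MatA N) 𝔸) (hloc : Localizes17OfRecord₁₃ F N θ S emb)
    (sp : (K k : ℕ) → (domSys (F.P K) M (k + 1)).Dom → Set (CPair (F.P K) 𝔸))
    {A R r₁ κ δ₀ B₃ r : ℝ} (Λt : ℕ → ℕ → ℝ) (hΛt : ∀ n i, 0 ≤ Λt n i)
    (hA : 0 ≤ A) (hr₁ : 0 ≤ r₁) (hrate : r₁ + 2 * (64 * Real.log 162) + 2 ≤ R) (hsmall : A * Real.exp (5 * r₁ + 1) * K₀ 64 8 * 9 * 64 ≤ 1)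
    (hκ₀ : kappa₀ (4 * 2 ^ 4) (2 * 4) ≤ κ / 2) (hδ₀ : 0 < δ₀) (hB₃ : 0 ≤ B₃) (hr : 0 < r)
    (hlet : ∀ (K k : ℕ), ∀ g ∈ box θ.γ k, ∀ (i : Fin (k + 1)), ∀ t ∈ Ioc (0 : ℝ) θ.γ, ∀ (X : (domSys (F.P K) M (k + 1)).Dom), ∀ φ ∈ sp K k X,
      ‖((S K) k).E g φ X - ((S K) k).E (Function.update g i t) φ X‖ ≤ Λt (k + 1) i * Real.exp (-(κ * (domSys (F.P K) M (k + 1)).dj X)) * |g i - t|)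
    (h238 : ∀ K k, ((S K) k).Bound238 (box θ.γ k) (sp K k) A R) (hAn : ∀ K k, ((S K) k).AnalyticH (box θ.γ k) (sp K k))
    (Ec : ℕ → ℕ → Type*) [∀ K k, NormedAddCommGroup (Ec K k)] [∀ K k, NormedSpace ℂ (Ec K k)]
    (ι : letI := θ.instVβ₁; letI := θ.instVβ₂
      (K k : ℕ) → (domSys (F.P K) M (k + 1)).Dom → ((Fin (F.P K).d → Site (F.P K) (k + 1) → θ.Vβ) →L[ℝ] Ec K k))
    (Φ : (K k : ℕ) → (domSys (F.P K) M (k + 1)).Dom → Ec K k → CPair (F.P K) 𝔸)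
    (U : (K k : ℕ) → (domSys (F.P K) M (k + 1)).Dom → Set (Ec K k)) (hU : ∀ K k X, IsOpen (U K k X)) (hrU : ∀ K k X, ball (0 : Ec K k) r ⊆ U K k X)
    (hΦhol : ∀ (K k : ℕ) (X : (domSys (F.P K) M (k + 1)).Dom), DifferentiableOn ℂ (Φ K k X) (U K k X))
    (hΦemb : letI := θ.instVβ₁; letI := θ.instVβ₂
      ∀ (K k : ℕ) (X : (domSys (F.P K) M (k + 1)).Dom) (B : Fin (F.P K).d → Site (F.P K) (k + 1) → θ.Vβ),
        Φ K k X (ι K k X B) = emb K k (fun l t => NormedSpace.exp (θ.ρ8 (B l t))))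
    (hΦsp : ∀ (K k : ℕ) (X : (domSys (F.P K) M (k + 1)).Dom), ∀ z ∈ U K k X, ∀ Z : (domSys (F.P K) M (k + 1)).Dom, Z.1 ⊆ X.1 → Φ K k X z ∈ sp K k Z)
    (w : (K k : ℕ) → (domSys (F.P K) M (k + 1)).Dom → Site (F.P K) (k + 1) → ℝ) (hw₀ : ∀ K k X t, 0 ≤ w K k X t)
    (hw : letI := θ.instVβ₁; letI := θ.instVβ₂; letI := θ.instιβ
      ∀ (K k : ℕ) (X : (domSys (F.P K) M (k + 1)).Dom) (l : Fin (F.P K).d) (t : Site (F.P K) (k + 1)) (c : θ.ιβ),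
        ‖ι K k X (Pi.single l (Pi.single t (θ.bV c)))‖ ≤ w K k X t)
    (htail : ∀ (K k : ℕ) (X : (domSys (F.P K) M (k + 1)).Dom) (t : Site (F.P K) (k + 1)),
      let e : Site (F.P K) (k + 1) → TPt 4 (domCount (F.P K) M (k + 1) * M) := fun x i => (ZMod.cast (x i) : ZMod (domCount (F.P K) M (k + 1) * M))
      w K k X t ≤ B₃ * Real.exp (-δ₀ * distCT (domCount (F.P K) M (k + 1)) M (e t) (nearT (M := M) (e t) X)))
    (hℓκ : ℓ.κ ≤ delta1 δ₀ κ ((M : ℝ) * 4))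
    (hdom : ∀ n i, 16 * B₃ ^ 2 / r ^ 2 * Real.exp (delta1 δ₀ κ ((M : ℝ) * 4) * ((M : ℝ) * 4) * 3) * K₀ (4 * 2 ^ 4) (2 * 4) * K₁ 4 (δ₀ / 2) * Λt n i ≤ ℓ.moduli n i) :
    NE9 ((objectsOfRecord₁₃ F N θ ℓ).EA 0) (Window θ.γ) ℓ.κ ℓ.moduli :=
  ne9_EA_objectsOfRecord₁₃_of_outputCoordLetters F N θ ℓ hs hlim m' M hM S emb hloc sp Λt hΛt hκ₀ hδ₀ hB₃ hr hlet Ec ι Φ U hU hrU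
    (differentiableOn_E_comp_of_printedSlots F S sp hA hr₁ hrate hsmall h238 hAn Ec Φ U hU hΦhol hΦsp)
    hΦemb (ball_mem_sp_of_spaceClause F sp Ec Φ U hrU hΦsp) w hw₀ hw htail hℓκ hdom

open Classical in
/-- ★★★ **THE N22 PIN FACE FROM OUTPUT-LEVEL COUPLING LETTERS + PRINTED (2.38) + PRINTED `AnalyticH`**, every run length `k`, under `hpin` — p616135's
`n22At_rateCarriers_of_kernels_pin_of_outputCoordLetters` with `hEhol` DISCHARGED by §0.  LOCATED (hypothesis form); N22 NOT discharged. -/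
theorem n22At_rateCarriers_of_kernels_pin_of_outputCoordLetters_analyticH (𝔯 : RateReading₁₃CoPH N) (θ : Stage13HParams F N) (hP : θ.Provisos₁₃CoPH F N)
    (g₀ : ℕ → ℝ) (os : List (ULoop F)) (ℓ : U3Letters₁₁) (hs : ℓ.Signs) (hpin : (𝔯.lit F θ hP g₀ os).u3 = objectsOfRecord₁₃ F N θ.toStage13Params ℓ)
    (hlim : PolLimitsExistOfRecord₁₃ F N θ.toStage13Params) {𝔸 : Type*} [NormedRing 𝔸] [NormedAlgebra ℂ 𝔸] (m' : ℕ) (M : ℕ) [NeZero M] (hM : M = F.L ^ m')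
    (S : (K : ℕ) → ClusterTower (F.P K) 𝔸 M) (emb : ReadingMaps F (MatA N) 𝔸) (hloc : Localizes17OfRecord₁₃ F N θ.toStage13Params S emb)
    (sp : (K k : ℕ) → (domSys (F.P K) M (k + 1)).Dom → Set (CPair (F.P K) 𝔸))
    {A R r₁ κ δ₀ B₃ r : ℝ} (Λt : ℕ → ℕ → ℝ) (hΛt : ∀ n i, 0 ≤ Λt n i)
    (hA : 0 ≤ A) (hr₁ : 0 ≤ r₁) (hrate : r₁ + 2 * (64 * Real.log 162) + 2 ≤ R) (hsmall : A * Real.exp (5 * r₁ + 1) * K₀ 64 8 * 9 * 64 ≤ 1)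
    (hκ₀ : kappa₀ (4 * 2 ^ 4) (2 * 4) ≤ κ / 2) (hδ₀ : 0 < δ₀) (hB₃ : 0 ≤ B₃) (hr : 0 < r)
    (hlet : ∀ (K k : ℕ), ∀ g ∈ box θ.γ k, ∀ (i : Fin (k + 1)), ∀ t ∈ Ioc (0 : ℝ) θ.γ, ∀ (X : (domSys (F.P K) M (k + 1)).Dom), ∀ φ ∈ sp K k X,
      ‖((S K) k).E g φ X - ((S K) k).E (Function.update g i t) φ X‖ ≤ Λt (k + 1) i * Real.exp (-(κ * (domSys (F.P K) M (k + 1)).dj X)) * |g i - t|)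
    (h238 : ∀ K k, ((S K) k).Bound238 (box θ.γ k) (sp K k) A R) (hAn : ∀ K k, ((S K) k).AnalyticH (box θ.γ k) (sp K k))
    (Ec : ℕ → ℕ → Type*) [∀ K k, NormedAddCommGroup (Ec K k)] [∀ K k, NormedSpace ℂ (Ec K k)]
    (ι : letI := θ.instVβ₁; letI := θ.instVβ₂
      (K k : ℕ) → (domSys (F.P K) M (k + 1)).Dom → ((Fin (F.P K).d → Site (F.P K) (k + 1) → θ.Vβ) →L[ℝ] Ec K k))
    (Φ : (K k : ℕ) → (domSys (F.P K) M (k + 1)).Dom → Ec K k → CPair (F.P K) 𝔸)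
    (U : (K k : ℕ) → (domSys (F.P K) M (k + 1)).Dom → Set (Ec K k)) (hU : ∀ K k X, IsOpen (U K k X)) (hrU : ∀ K k X, ball (0 : Ec K k) r ⊆ U K k X)
    (hΦhol : ∀ (K k : ℕ) (X : (domSys (F.P K) M (k + 1)).Dom), DifferentiableOn ℂ (Φ K k X) (U K k X))
    (hΦemb : letI := θ.instVβ₁; letI := θ.instVβ₂
      ∀ (K k : ℕ) (X : (domSys (F.P K) M (k + 1)).Dom) (B : Fin (F.P K).d → Site (F.P K) (k + 1) → θ.Vβ),
        Φ K k X (ι K k X B) = emb K k (fun l t => NormedSpace.exp (θ.ρ8 (B l t))))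
    (hΦsp : ∀ (K k : ℕ) (X : (domSys (F.P K) M (k + 1)).Dom), ∀ z ∈ U K k X, ∀ Z : (domSys (F.P K) M (k + 1)).Dom, Z.1 ⊆ X.1 → Φ K k X z ∈ sp K k Z)
    (w : (K k : ℕ) → (domSys (F.P K) M (k + 1)).Dom → Site (F.P K) (k + 1) → ℝ) (hw₀ : ∀ K k X t, 0 ≤ w K k X t)
    (hw : letI := θ.instVβ₁; letI := θ.instVβ₂; letI := θ.instιβ
      ∀ (K k : ℕ) (X : (domSys (F.P K) M (k + 1)).Dom) (l : Fin (F.P K).d) (t : Site (F.P K) (k + 1)) (c : θ.ιβ),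
        ‖ι K k X (Pi.single l (Pi.single t (θ.bV c)))‖ ≤ w K k X t)
    (htail : ∀ (K k : ℕ) (X : (domSys (F.P K) M (k + 1)).Dom) (t : Site (F.P K) (k + 1)),
      let e : Site (F.P K) (k + 1) → TPt 4 (domCount (F.P K) M (k + 1) * M) := fun x i => (ZMod.cast (x i) : ZMod (domCount (F.P K) M (k + 1) * M))
      w K k X t ≤ B₃ * Real.exp (-δ₀ * distCT (domCount (F.P K) M (k + 1)) M (e t) (nearT (M := M) (e t) X)))
    (hℓκ : ℓ.κ ≤ delta1 δ₀ κ ((M : ℝ) * 4))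
    (hdom : ∀ n i, 16 * B₃ ^ 2 / r ^ 2 * Real.exp (delta1 δ₀ κ ((M : ℝ) * 4) * ((M : ℝ) * 4) * 3) * K₀ (4 * 2 ^ 4) (2 * 4) * K₁ 4 (δ₀ / 2) * Λt n i ≤ ℓ.moduli n i) (k : ℕ) :
    N22At (rateCarriersOfRecord₁₃CoPH 𝔯 F θ hP g₀ os k).u3 :=
  n22At_rateCarriers_of_kernels_pin_of_outputCoordLetters F N 𝔯 θ hP g₀ os ℓ hs hpin hlim m' M hM S emb hloc sp Λt hΛt hκ₀ hδ₀ hB₃ hr hlet Ec ι Φ U hU hrU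
    (differentiableOn_E_comp_of_printedSlots F S sp hA hr₁ hrate hsmall h238 hAn Ec Φ U hU hΦhol hΦsp)
    hΦemb (ball_mem_sp_of_spaceClause F sp Ec Φ U hrU hΦsp) w hw₀ hw htail hℓκ hdom k

/-! ## §2 `hdec` and the (D4) pin face from printed (1.18) `TermBound118` + print's slots -/

open Classical in
/-- ★★★ **K3⁷ v5 §2b's `hdec` FROM PRINTED (1.18) `TermBound118` + PRINTED (2.38) + PRINTED `AnalyticH`.**  `…OutputValue` §2 `kernelDecayOfRecord₁₃_of_termBound118` (J36 at the record)
with its term-holomorphy binder `hEhol` DISCHARGED by §0 at the tables `sp K k := spj K (k+1)`: law + `TermBound118 (S K) (Window θ.γ) (spj K) B κ_E` per torus + `Bound238` ∕ `AnalyticH`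
on the boxes + numerals + holomorphic readings with chart∕space clauses + tails + `2κ₀(64,8) ≤ κ ≤ κ_E`, `δ₀ > 0` + `PolLimitsExistOfRecord₁₃ F N θ` ⟹ `KernelDecayOfRecord₁₃ F N θ μ ν κ′` at any
`κ′ ≤ δ₁`.  LOCATED (hypothesis form); (D4) NOT discharged. -/
theorem kernelDecayOfRecord₁₃_of_termBound118_analyticH (θ : Stage13Params F N) (hlim : PolLimitsExistOfRecord₁₃ F N θ)
    {𝔸 : Type*} [NormedRing 𝔸] [NormedAlgebra ℂ 𝔸] (m' : ℕ) (M : ℕ) [NeZero M] (hM : M = F.L ^ m')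
    (S : (K : ℕ) → ClusterTower (F.P K) 𝔸 M) (emb : ReadingMaps F (MatA N) 𝔸) (hloc : Localizes17OfRecord₁₃ F N θ S emb)
    (spj : (K j : ℕ) → (domSys (F.P K) M j).Dom → Set (CPair (F.P K) 𝔸))
    {A R r₁ κ κE δ₀ B₃ r B κ' : ℝ}
    (hA : 0 ≤ A) (hr₁ : 0 ≤ r₁) (hrate : r₁ + 2 * (64 * Real.log 162) + 2 ≤ R) (hsmall : A * Real.exp (5 * r₁ + 1) * K₀ 64 8 * 9 * 64 ≤ 1)
    (hκ₀ : kappa₀ (4 * 2 ^ 4) (2 * 4) ≤ κ / 2) (hδ₀ : 0 < δ₀) (hB₃ : 0 ≤ B₃) (hr : 0 < r) (hB : 0 ≤ B) (hκE : κ ≤ κE)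
    (hT : ∀ K : ℕ, TermBound118 (S K) (Window θ.γ) (spj K) B κE)
    (h238 : ∀ K k, ((S K) k).Bound238 (box θ.γ k) (spj K (k + 1)) A R) (hAn : ∀ K k, ((S K) k).AnalyticH (box θ.γ k) (spj K (k + 1)))
    (Ec : ℕ → ℕ → Type*) [∀ K k, NormedAddCommGroup (Ec K k)] [∀ K k, NormedSpace ℂ (Ec K k)]
    (ι : letI := θ.instVβ₁; letI := θ.instVβ₂
      (K k : ℕ) → (domSys (F.P K) M (k + 1)).Dom → ((Fin (F.P K).d → Site (F.P K) (k + 1) → θ.Vβ) →L[ℝ] Ec K k))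
    (Φ : (K k : ℕ) → (domSys (F.P K) M (k + 1)).Dom → Ec K k → CPair (F.P K) 𝔸)
    (U : (K k : ℕ) → (domSys (F.P K) M (k + 1)).Dom → Set (Ec K k)) (hU : ∀ K k X, IsOpen (U K k X)) (hrU : ∀ K k X, ball (0 : Ec K k) r ⊆ U K k X)
    (hΦhol : ∀ (K k : ℕ) (X : (domSys (F.P K) M (k + 1)).Dom), DifferentiableOn ℂ (Φ K k X) (U K k X))
    (hΦemb : letI := θ.instVβ₁; letI := θ.instVβ₂
      ∀ (K k : ℕ) (X : (domSys (F.P K) M (k + 1)).Dom) (Bp : Fin (F.P K).d → Site (F.P K) (k + 1) → θ.Vβ),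
        Φ K k X (ι K k X Bp) = emb K k (fun l t => NormedSpace.exp (θ.ρ8 (Bp l t))))
    (hΦsp : ∀ (K k : ℕ) (X : (domSys (F.P K) M (k + 1)).Dom), ∀ z ∈ U K k X, ∀ Z : (domSys (F.P K) M (k + 1)).Dom, Z.1 ⊆ X.1 → Φ K k X z ∈ spj K (k + 1) Z)
    (w : (K k : ℕ) → (domSys (F.P K) M (k + 1)).Dom → Site (F.P K) (k + 1) → ℝ) (hw₀ : ∀ K k X t, 0 ≤ w K k X t)
    (hw : letI := θ.instVβ₁; letI := θ.instVβ₂; letI := θ.instιβ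
      ∀ (K k : ℕ) (X : (domSys (F.P K) M (k + 1)).Dom) (l : Fin (F.P K).d) (t : Site (F.P K) (k + 1)) (c : θ.ιβ),
        ‖ι K k X (Pi.single l (Pi.single t (θ.bV c)))‖ ≤ w K k X t)
    (htail : ∀ (K k : ℕ) (X : (domSys (F.P K) M (k + 1)).Dom) (t : Site (F.P K) (k + 1)),
      let e : Site (F.P K) (k + 1) → TPt 4 (domCount (F.P K) M (k + 1) * M) := fun x i => (ZMod.cast (x i) : ZMod (domCount (F.P K) M (k + 1) * M))
      w K k X t ≤ B₃ * Real.exp (-δ₀ * distCT (domCount (F.P K) M (k + 1)) M (e t) (nearT (M := M) (e t) X)))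
    (hκ' : κ' ≤ delta1 δ₀ κ ((M : ℝ) * 4)) (μ ν : Fin 4) :
    KernelDecayOfRecord₁₃ F N θ μ ν κ' :=
  kernelDecayOfRecord₁₃_of_termBound118 F N θ hlim m' M hM S emb hloc spj hκ₀ hδ₀ hB₃ hr hB hκE hT Ec ι Φ U hU hrU
    (differentiableOn_E_comp_of_printedSlots F S (fun K k => spj K (k + 1)) hA hr₁ hrate hsmall h238 hAn Ec Φ U hU hΦhol hΦsp)
    hΦemb (ball_mem_sp_of_spaceClause F (fun K k => spj K (k + 1)) Ec Φ U hrU hΦsp) w hw₀ hw htail hκ' μ ν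

open Classical in
/-- ★★★ **THE (D4) PIN FACE IN PRINT-LEVEL CURRENCY**, every run length `k`, under `hpin`, for a letter block with `ℓ.Signs`, `0 < ℓ.κ ≤ δ₁`, `β′₅.₁₀(4,1,ℓ.κ) ≤ ℓ.cr`: `…OutputValue` §2
`readOutAt_rateCarriers_of_kernels_pin_of_termBound118` with `hEhol` DISCHARGED from PRINTED (2.38) + PRINTED `AnalyticH` (§0).  «W1-20's law + printed (1.18) + printed (2.38) + printed
configuration analyticity + holomorphic minimizer readings + p. 282 tails + (1.21) + numerals ⇒ the (D4) pin face at the pinned bundle, every run length»; (5.10) REDUCED by dag-n27-w1,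
NOT discharged.  LOCATED (hypothesis form); (D4) NOT discharged. -/
theorem readOutAt_rateCarriers_of_kernels_pin_of_termBound118_analyticH (𝔯 : RateReading₁₃CoPH N) (θ : Stage13HParams F N) (hP : θ.Provisos₁₃CoPH F N)
    (g₀ : ℕ → ℝ) (os : List (ULoop F)) (ℓ : U3Letters₁₁) (hs : ℓ.Signs) (hℓ₀ : 0 < ℓ.κ) (hcr : betaPrime510 4 1 ℓ.κ ≤ ℓ.cr)
    (hpin : (𝔯.lit F θ hP g₀ os).u3 = objectsOfRecord₁₃ F N θ.toStage13Params ℓ)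
    (hlim : PolLimitsExistOfRecord₁₃ F N θ.toStage13Params) {𝔸 : Type*} [NormedRing 𝔸] [NormedAlgebra ℂ 𝔸] (m' : ℕ) (M : ℕ) [NeZero M] (hM : M = F.L ^ m')
    (S : (K : ℕ) → ClusterTower (F.P K) 𝔸 M) (emb : ReadingMaps F (MatA N) 𝔸) (hloc : Localizes17OfRecord₁₃ F N θ.toStage13Params S emb)
    (spj : (K j : ℕ) → (domSys (F.P K) M j).Dom → Set (CPair (F.P K) 𝔸))
    {A R r₁ κ κE δ₀ B₃ r B : ℝ}
    (hA : 0 ≤ A) (hr₁ : 0 ≤ r₁) (hrate : r₁ + 2 * (64 * Real.log 162) + 2 ≤ R) (hsmall : A * Real.exp (5 * r₁ + 1) * K₀ 64 8 * 9 * 64 ≤ 1)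
    (hκ₀ : kappa₀ (4 * 2 ^ 4) (2 * 4) ≤ κ / 2) (hδ₀ : 0 < δ₀) (hB₃ : 0 ≤ B₃) (hr : 0 < r) (hB : 0 ≤ B) (hκE : κ ≤ κE)
    (hT : ∀ K : ℕ, TermBound118 (S K) (Window θ.γ) (spj K) B κE)
    (h238 : ∀ K k, ((S K) k).Bound238 (box θ.γ k) (spj K (k + 1)) A R) (hAn : ∀ K k, ((S K) k).AnalyticH (box θ.γ k) (spj K (k + 1)))
    (Ec : ℕ → ℕ → Type*) [∀ K k, NormedAddCommGroup (Ec K k)] [∀ K k, NormedSpace ℂ (Ec K k)]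
    (ι : letI := θ.instVβ₁; letI := θ.instVβ₂
      (K k : ℕ) → (domSys (F.P K) M (k + 1)).Dom → ((Fin (F.P K).d → Site (F.P K) (k + 1) → θ.Vβ) →L[ℝ] Ec K k))
    (Φ : (K k : ℕ) → (domSys (F.P K) M (k + 1)).Dom → Ec K k → CPair (F.P K) 𝔸)
    (U : (K k : ℕ) → (domSys (F.P K) M (k + 1)).Dom → Set (Ec K k)) (hU : ∀ K k X, IsOpen (U K k X)) (hrU : ∀ K k X, ball (0 : Ec K k) r ⊆ U K k X)
    (hΦhol : ∀ (K k : ℕ) (X : (domSys (F.P K) M (k + 1)).Dom), DifferentiableOn ℂ (Φ K k X) (U K k X))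
    (hΦemb : letI := θ.instVβ₁; letI := θ.instVβ₂
      ∀ (K k : ℕ) (X : (domSys (F.P K) M (k + 1)).Dom) (Bp : Fin (F.P K).d → Site (F.P K) (k + 1) → θ.Vβ),
        Φ K k X (ι K k X Bp) = emb K k (fun l t => NormedSpace.exp (θ.ρ8 (Bp l t))))
    (hΦsp : ∀ (K k : ℕ) (X : (domSys (F.P K) M (k + 1)).Dom), ∀ z ∈ U K k X, ∀ Z : (domSys (F.P K) M (k + 1)).Dom, Z.1 ⊆ X.1 → Φ K k X z ∈ spj K (k + 1) Z)
    (w : (K k : ℕ) → (domSys (F.P K) M (k + 1)).Dom → Site (F.P K) (k + 1) → ℝ) (hw₀ : ∀ K k X t, 0 ≤ w K k X t)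
    (hw : letI := θ.instVβ₁; letI := θ.instVβ₂; letI := θ.instιβ
      ∀ (K k : ℕ) (X : (domSys (F.P K) M (k + 1)).Dom) (l : Fin (F.P K).d) (t : Site (F.P K) (k + 1)) (c : θ.ιβ),
        ‖ι K k X (Pi.single l (Pi.single t (θ.bV c)))‖ ≤ w K k X t)
    (htail : ∀ (K k : ℕ) (X : (domSys (F.P K) M (k + 1)).Dom) (t : Site (F.P K) (k + 1)),
      let e : Site (F.P K) (k + 1) → TPt 4 (domCount (F.P K) M (k + 1) * M) := fun x i => (ZMod.cast (x i) : ZMod (domCount (F.P K) M (k + 1) * M))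
      w K k X t ≤ B₃ * Real.exp (-δ₀ * distCT (domCount (F.P K) M (k + 1)) M (e t) (nearT (M := M) (e t) X)))
    (hℓκ : ℓ.κ ≤ delta1 δ₀ κ ((M : ℝ) * 4)) (k : ℕ) :
    ReadOutAt (datumOfRecord₁₃CoPH F N θ hP) (rateCarriersOfRecord₁₃CoPH 𝔯 F θ hP g₀ os k).u3 :=
  readOutAt_rateCarriers_of_kernels_pin_of_termBound118 F N 𝔯 θ hP g₀ os ℓ hs hℓ₀ hcr hpin hlim m' M hM S emb hloc spj hκ₀ hδ₀ hB₃ hr hB hκE hT Ec ι Φ U hU hrU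
    (differentiableOn_E_comp_of_printedSlots F S (fun K k => spj K (k + 1)) hA hr₁ hrate hsmall h238 hAn Ec Φ U hU hΦhol hΦsp)
    hΦemb (ball_mem_sp_of_spaceClause F (fun K k => spj K (k + 1)) Ec Φ U hrU hΦsp) w hw₀ hw htail hℓκ k

end YMDAG.N22.AtRecordOfPrintedSlots

end
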